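import Summits.AtomisticToContinuum.BoseEinsteinCondensation.Theorems.BECThomsonPrincipleGDTransferSeededPlainFormsInt

/-!
# Route `BECThomsonPrinciple`, crux `GDTransfer` (stmt-AtomisticToContinuum-9482), line `seeded-continuity`:
# stub `stub_bandEmptinessInt`, part 2 — INTEGRABLE pair weights, the local terms of one pair

Support file (part 2) of the registered stub `stub_bandEmptinessInt` of skeleton v7, continuing part 1
(`…SeededPlainFormsInt`).  Twins (suffix `_int`) of the lemmas of `…SeededPlainPairsBdd` in which the bound on the
periodisation at the given side, `∀ x, v^per_L(x) ≤ C`, is replaced by what an admissible profile finite on `[0, ∞)`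
with integrable lift has at a side `L > 0`: FINITENESS of the periodisation, `∀ x, v^per_L(x) < ∞`, and integrability
of the lift, `‖v‖₁ = ∫_{ℝ³} v(|x|)dx < ∞`:
* the one new fact: **the pair weight integrates like the profile**, `∫_{cell^N} v^per(x_p − x_q) dX = L⁻³‖v‖₁|cell^N|`
  for `p ≠ q` (Fubini in slot `p` unfolds the periodisation, `Bare.lintegral_cellN_slotAvg` + `Bare.slotAvg_pairPot`),
  so the real pair weight `X ↦ v^per(x_p − x_q)` is in `L¹(cell^N)` (`integrableOn_pairWeight`) — the hypothesis of
  the integrable-weight forms of part 1;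
* the real periodic interaction as the sum of the pair weights, the pair form read in `ℝ≥0∞`, JENSEN IN A SLOT OF THE
  PAIR (exact) `∫ v^per(x_p − x_q)|h|² = L⁻³‖v‖₁ · ∫|h|²` for continuous `h` flat in a slot `k ∈ {p,q}`;
* for one pair `{p,q}`: rows `i ∉ {p,q}` purely imaginary, entries `i ∈ {p,q} ∌ j` vanishing (adjointness of `b_i`,
  `P_i^{(n)}` against the integrable pair weight, part 1), and the four local bounds
  `|t₁|, |t₂| ≤ L⁻³‖v‖₁`, `|t₃|, |t₄| ≤ √(L⁻³‖v‖₁)√(∫v^per_pq|ψ|²)` (`pair_local_bounds_int`; registered helper statement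
  `plainPairsInt_pair_local_bound`).
All [folklore] (KennedyLiebShastry1988 §2; arXiv:1211.2778 §2; LSSY2005 App. A).
-/

noncomputable section

open MeasureTheory Filter
open scoped ENNReal NNReal ComplexConjugate

namespace Summit.AtomisticToContinuum.BoseEinsteinCondensation.Cruxes.GDTransfer.Seeded

namespace PlainInteraction

open Literature.MathematicalPhysics.QuantumManyBody.BoseGas
open Summit.AtomisticToContinuum.BoseEinsteinCondensation.Theorems.GaussianDominationCan.Negative
open Summit.AtomisticToContinuum.BoseEinsteinCondensation.Cruxes.GDTransfer.DysonDressedWitness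
open Lnss Sector

variable {N m : ℕ} {L : ℝ}

/-! ## The pair weights `v^per(x_p − x_q)` of a profile with finite periodisation and integrable lift -/

section PairWeightInt

variable {v : ℝ → ℝ≥0∞}

/-- **The pair weight integrates like the profile**: for `p ≠ q` and `L > 0`,
`∫⁻_{cell^N} v^per(x_p − x_q) dX = L⁻³‖v‖₁ · |cell^N|` (Fubini in slot `p` unfolds the periodisation). [folklore] -/
theorem lintegral_pairWeight {n' : ℕ} (hL : 0 < L) (hv : Measurable v) {p q : Fin (n' + 1)} (hpq : p ≠ q) :
    ∫⁻ X in cellN (n' + 1) L, periodizedPotential v L (X p - X q) =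
      (ENNReal.ofReal (L ^ 3))⁻¹ * (∫⁻ x : Space, v ‖x‖) * volume (cellN (n' + 1) L) := by
  have hW := Bare.measurable_pairPot hv L p q (N := n' + 1)
  calc ∫⁻ X in cellN (n' + 1) L, periodizedPotential v L (X p - X q)
      = ∫⁻ X in cellN (n' + 1) L, (ENNReal.ofReal (L ^ 3))⁻¹ *
          ∫⁻ y in cell L, periodizedPotential v L (Function.update X p y p - Function.update X p y q) :=
        (Bare.lintegral_cellN_slotAvg hL p hW).symm
    _ = ∫⁻ _X in cellN (n' + 1) L, (ENNReal.ofReal (L ^ 3))⁻¹ * ∫⁻ x : Space, v ‖x‖ :=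
        lintegral_congr fun X => by rw [Bare.slotAvg_pairPot hL hv hpq (Or.inl rfl) X]
    _ = (ENNReal.ofReal (L ^ 3))⁻¹ * (∫⁻ x : Space, v ‖x‖) * volume (cellN (n' + 1) L) := by
        rw [setLIntegral_const]

/-- The pair weight of `p ≠ q` has finite integral over the cell when the lift is integrable (`L > 0`). [folklore] -/
theorem lintegral_pairWeight_ne_top {n' : ℕ} (hL : 0 < L) (hv : Measurable v) (hint : (∫⁻ x : Space, v ‖x‖) ≠ ⊤)
    {p q : Fin (n' + 1)} (hpq : p ≠ q) : ∫⁻ X in cellN (n' + 1) L, periodizedPotential v L (X p - X q) ≠ ⊤ := by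
  rw [lintegral_pairWeight hL hv hpq, volume_cellN]
  exact ENNReal.mul_ne_top
    (ENNReal.mul_ne_top (ENNReal.inv_ne_top.2 (ENNReal.ofReal_pos.2 (by positivity)).ne') hint)
    (ENNReal.pow_ne_top (ENNReal.pow_ne_top ENNReal.ofReal_ne_top))

/-- **The real pair weight `X ↦ v^per(x_p − x_q)` is integrable on the cell** for a measurable profile with
integrable lift (`L > 0`; for `p = q` it is constant on the finite-measure cell). [folklore] -/
theorem integrableOn_pairWeight {n' : ℕ} (hL : 0 < L) (hv : IsRepulsiveFiniteRange v)
    (hint : (∫⁻ x : Space, v ‖x‖) ≠ ⊤) (p q : Fin (n' + 1)) :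
    IntegrableOn (fun X : Config (n' + 1) => (periodizedPotential v L (X p - X q)).toReal) (cellN (n' + 1) L) := by
  by_cases hpq : p = q
  · subst hpq
    simp only [sub_self]
    exact integrableOn_const (hs := by
      rw [volume_cellN]; exact ENNReal.pow_ne_top (ENNReal.pow_ne_top ENNReal.ofReal_ne_top))
  · refine ⟨(measurable_pairWeight hv L p q).aestronglyMeasurable, ?_⟩
    refine lt_of_le_of_lt (lintegral_mono fun X => ?_) (lintegral_pairWeight_ne_top hL hv.1 hint hpq).lt_top
    rw [Real.enorm_eq_ofReal ENNReal.toReal_nonneg]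
    exact ENNReal.ofReal_toReal_le

/-- The real periodic interaction is the sum of the real pair weights (finite periodisation). [folklore] -/
theorem toReal_periodicInteraction_int (hfin : ∀ x, periodizedPotential v L x ≠ ⊤) (X : Config N) :
    (periodicInteraction v L X).toReal =
      ∑ p : Fin N, ∑ q ∈ (Finset.univ : Finset (Fin N)).filter (fun q => p < q),
        (periodizedPotential v L (X p - X q)).toReal := by
  unfold periodicInteraction
  rw [ENNReal.toReal_sum fun p _ => ENNReal.sum_ne_top.2 fun q _ => hfin _]
  exact Finset.sum_congr rfl fun p _ => ENNReal.toReal_sum fun q _ => hfin _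

/-- The real pair form read in `ℝ≥0∞`: `ofReal (∫ v^per_{pq}|h|²) = ∫⁻ v^per_{pq} ‖h‖₊²` (finite periodisation,
integrable lift, continuous `h`). [folklore] -/
theorem ofReal_integral_pairWeight_norm_sq_int {n' : ℕ} (hL : 0 < L) (hv : IsRepulsiveFiniteRange v)
    (hfin : ∀ x, periodizedPotential v L x ≠ ⊤) (hint : (∫⁻ x : Space, v ‖x‖) ≠ ⊤) (p q : Fin (n' + 1))
    {h : Config (n' + 1) → ℂ} (hh : Continuous h) :
    ENNReal.ofReal (∫ X in cellN (n' + 1) L, (periodizedPotential v L (X p - X q)).toReal * ‖h X‖ ^ 2) =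
      ∫⁻ X in cellN (n' + 1) L, periodizedPotential v L (X p - X q) * ((‖h X‖₊ : ℝ≥0∞)) ^ 2 := by
  rw [ofReal_integral_weight_norm_sq_int (integrableOn_pairWeight hL hv hint p q) (fun X => ENNReal.toReal_nonneg) hh]
  exact lintegral_congr fun X => by rw [ENNReal.ofReal_toReal (hfin _)]

/-- **Jensen in a slot of the pair (exact)**, finite periodisation and integrable lift: for continuous `h` FLAT in a
slot `k ∈ {p, q}` (`p ≠ q`), `∫ v^per(x_p − x_q)|h|² = L⁻³‖v‖₁ · ∫|h|²`. [folklore] -/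
theorem integral_pairWeight_norm_sq_flat_int {n' : ℕ} (hL : 0 < L) (hv : IsRepulsiveFiniteRange v)
    (hfin : ∀ x, periodizedPotential v L x ≠ ⊤) (hint : (∫⁻ x : Space, v ‖x‖) ≠ ⊤) {k p q : Fin (n' + 1)}
    (hpq : p ≠ q) (hk : k = p ∨ k = q) {h : Config (n' + 1) → ℂ} (hh : Continuous h)
    (hflat : ∀ X z, h (Function.update X k z) = h X) :
    ∫ X in cellN (n' + 1) L, (periodizedPotential v L (X p - X q)).toReal * ‖h X‖ ^ 2 =
      ((ENNReal.ofReal (L ^ 3))⁻¹ * ∫⁻ x : Space, v ‖x‖).toReal * ∫ X in cellN (n' + 1) L, ‖h X‖ ^ 2 := by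
  -- adapted from `integral_pairWeight_norm_sq_flat_bdd` (bounded periodisation)
  have hW := Bare.measurable_pairPot hv.1 L p q (N := n' + 1)
  have hflat' : ∀ (X : Config (n' + 1)) (y : Space),
      ((‖h (Function.update X k y)‖₊ : ℝ≥0∞)) ^ 2 = ((‖h X‖₊ : ℝ≥0∞)) ^ 2 := fun X y => by rw [hflat]
  have key : ∫⁻ X in cellN (n' + 1) L, periodizedPotential v L (X p - X q) * ((‖h X‖₊ : ℝ≥0∞)) ^ 2 =
      (ENNReal.ofReal (L ^ 3))⁻¹ * (∫⁻ x : Space, v ‖x‖) * mass L h := by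
    calc ∫⁻ X in cellN (n' + 1) L, periodizedPotential v L (X p - X q) * ((‖h X‖₊ : ℝ≥0∞)) ^ 2
        = ∫⁻ X in cellN (n' + 1) L, ((‖h X‖₊ : ℝ≥0∞)) ^ 2 * periodizedPotential v L (X p - X q) :=
          lintegral_congr fun X => mul_comm _ _
      _ = ∫⁻ X in cellN (n' + 1) L, ((‖h X‖₊ : ℝ≥0∞)) ^ 2 *
            ((ENNReal.ofReal (L ^ 3))⁻¹ * ∫⁻ y in cell L,
              periodizedPotential v L (Function.update X k y p - Function.update X k y q)) :=
          (Bare.lintegral_cellN_mul_slotAvg hL k (Bare.measurable_nnnorm_sq hh.measurable) hW hflat').symm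
      _ = ∫⁻ X in cellN (n' + 1) L, ((‖h X‖₊ : ℝ≥0∞)) ^ 2 *
            ((ENNReal.ofReal (L ^ 3))⁻¹ * ∫⁻ x : Space, v ‖x‖) :=
          lintegral_congr fun X => by rw [Bare.slotAvg_pairPot hL hv.1 hpq hk X]
      _ = (ENNReal.ofReal (L ^ 3))⁻¹ * (∫⁻ x : Space, v ‖x‖) * mass L h := by
          rw [lintegral_mul_const _ (Bare.measurable_nnnorm_sq hh.measurable), mul_comm]; rfl
  have hI0 : 0 ≤ ∫ X in cellN (n' + 1) L, (periodizedPotential v L (X p - X q)).toReal * ‖h X‖ ^ 2 :=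
    integral_nonneg fun X => mul_nonneg ENNReal.toReal_nonneg (sq_nonneg _)
  have hm : (mass L h).toReal = ∫ X in cellN (n' + 1) L, ‖h X‖ ^ 2 := by
    unfold mass
    rw [lintegral_nnnorm_sq_eq _ hh, ENNReal.toReal_ofReal (integral_nonneg fun X => sq_nonneg _)]
  rw [← ENNReal.toReal_ofReal hI0, ofReal_integral_pairWeight_norm_sq_int hL hv hfin hint p q hh, key,
    ENNReal.toReal_mul, hm]

end PairWeightInt

/-! ## The local terms of one pair: adjointness rows, vanishing entries, bounds (integrable pair weight) -/

section OnePairInt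

variable {v : ℝ → ℝ≥0∞} {n : Fin 3 → ℤ} {p q : Fin (m + 1)} {ψ : Config (m + 1) → ℂ}

/-- **Rows `i ∉ {p,q}` are purely imaginary, first half**: `𝓥_pq(b_iψ, b_jψ) = conj 𝓥_pq(P_i^{(n)}(b_jψ), ψ)`
(adjointness of `b_i` against the integrable pair weight, which is flat in slot `i`). [folklore] -/
theorem pair_t1_eq_conj_t4_int (hL : 0 < L) (hv : IsRepulsiveFiniteRange v) (hint : (∫⁻ x : Space, v ‖x‖) ≠ ⊤)
    (n : Fin 3 → ℤ) {i : Fin (m + 1)} (hip : p ≠ i) (hiq : q ≠ i) (j : Fin (m + 1)) (hψ : Continuous ψ) :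
    ∫ X in cellN (m + 1) L, (((periodizedPotential v L (X p - X q)).toReal : ℝ) : ℂ) *
        (conj (cellWave L n (X i) * cellAvg (m + 1) L i ψ X) * (cellWave L n (X j) * cellAvg (m + 1) L j ψ X)) =
      conj (∫ X in cellN (m + 1) L, (((periodizedPotential v L (X p - X q)).toReal : ℝ) : ℂ) *
        (conj (fourierAvg m L n i (fun Y => cellWave L n (Y j) * cellAvg (m + 1) L j ψ Y) X) * ψ X)) := by
  rw [form_up_adjoint_int n i (integrableOn_pairWeight hL hv hint p q) (pairWeight_update v L hip hiq) hψ
    (continuous_up n j hψ), form_conj_symm]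

/-- **Rows `i ∉ {p,q}` are purely imaginary, second half**:
`𝓥_pq(P_i^{(n)}ψ, P_j^{(n)}ψ) = conj 𝓥_pq(b_i(P_j^{(n)}ψ), ψ)`. [folklore] -/
theorem pair_t2_eq_conj_t3_int (hL : 0 < L) (hv : IsRepulsiveFiniteRange v) (hint : (∫⁻ x : Space, v ‖x‖) ≠ ⊤)
    (n : Fin 3 → ℤ) {i : Fin (m + 1)} (hip : p ≠ i) (hiq : q ≠ i) (j : Fin (m + 1)) (hψ : Continuous ψ) :
    ∫ X in cellN (m + 1) L, (((periodizedPotential v L (X p - X q)).toReal : ℝ) : ℂ) *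
        (conj (fourierAvg m L n i ψ X) * fourierAvg m L n j ψ X) =
      conj (∫ X in cellN (m + 1) L, (((periodizedPotential v L (X p - X q)).toReal : ℝ) : ℂ) *
        (conj (cellWave L n (X i) * cellAvg (m + 1) L i (fourierAvg m L n j ψ) X) * ψ X)) := by
  rw [form_down_adjoint_int n i (integrableOn_pairWeight hL hv hint p q) (pairWeight_update v L hip hiq) hψ
    (continuous_fourierAvg n j hψ), form_conj_symm]

/-- **Entries `i ∈ {p,q}`, `j ∉ {p,q}` vanish, first half**: `𝓥_pq(b_iψ, b_jψ) = 𝓥_pq(b_i(P_j^{(n)}ψ), ψ)`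
(adjointness in slot `j` and the mixed commutation `b_i P_j^{(n)} = P_j^{(n)} b_i`). [folklore] -/
theorem pair_t1_eq_t3_int (hL : 0 < L) (hv : IsRepulsiveFiniteRange v) (hint : (∫⁻ x : Space, v ‖x‖) ≠ ⊤)
    (n : Fin 3 → ℤ) {i j : Fin (m + 1)} (hij : i ≠ j) (hjp : p ≠ j) (hjq : q ≠ j) (hψ : Continuous ψ) :
    ∫ X in cellN (m + 1) L, (((periodizedPotential v L (X p - X q)).toReal : ℝ) : ℂ) *
        (conj (cellWave L n (X i) * cellAvg (m + 1) L i ψ X) * (cellWave L n (X j) * cellAvg (m + 1) L j ψ X)) =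
      ∫ X in cellN (m + 1) L, (((periodizedPotential v L (X p - X q)).toReal : ℝ) : ℂ) *
        (conj (cellWave L n (X i) * cellAvg (m + 1) L i (fourierAvg m L n j ψ) X) * ψ X) := by
  rw [form_conj_symm _ (fun X => cellWave L n (X j) * cellAvg (m + 1) L j ψ X),
    form_up_adjoint_int n j (integrableOn_pairWeight hL hv hint p q) (pairWeight_update v L hjp hjq) hψ
      (continuous_up n i hψ), form_conj_symm _ _ ψ, Complex.conj_conj, ← up_down_comm n hij hψ]

/-- **Entries `i ∈ {p,q}`, `j ∉ {p,q}` vanish, second half**: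
`𝓥_pq(P_i^{(n)}ψ, P_j^{(n)}ψ) = 𝓥_pq(P_i^{(n)}(b_jψ), ψ)`. [folklore] -/
theorem pair_t2_eq_t4_int (hL : 0 < L) (hv : IsRepulsiveFiniteRange v) (hint : (∫⁻ x : Space, v ‖x‖) ≠ ⊤)
    (n : Fin 3 → ℤ) {i j : Fin (m + 1)} (hij : i ≠ j) (hjp : p ≠ j) (hjq : q ≠ j) (hψ : Continuous ψ) :
    ∫ X in cellN (m + 1) L, (((periodizedPotential v L (X p - X q)).toReal : ℝ) : ℂ) *
        (conj (fourierAvg m L n i ψ X) * fourierAvg m L n j ψ X) =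
      ∫ X in cellN (m + 1) L, (((periodizedPotential v L (X p - X q)).toReal : ℝ) : ℂ) *
        (conj (fourierAvg m L n i (fun Y => cellWave L n (Y j) * cellAvg (m + 1) L j ψ Y) X) * ψ X) := by
  rw [form_conj_symm _ (fourierAvg m L n j ψ),
    form_down_adjoint_int n j (integrableOn_pairWeight hL hv hint p q) (pairWeight_update v L hjp hjq) hψ
      (continuous_fourierAvg n i hψ), form_conj_symm _ _ ψ, Complex.conj_conj, ← up_down_comm n hij.symm hψ]

/-- **Jensen bound for a flat unit-mass function** (finite periodisation, integrable lift): `∫ v^per_{pq}|h|² ≤ L⁻³‖v‖₁`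
for continuous `h` flat in a slot of the pair with `∫|h|² ≤ 1`. [folklore] -/
theorem integral_pairWeight_norm_sq_le_int (hL : 0 < L) (hv : IsRepulsiveFiniteRange v)
    (hfin : ∀ x, periodizedPotential v L x ≠ ⊤) (hint : (∫⁻ x : Space, v ‖x‖) ≠ ⊤) (hpq : p ≠ q) {k : Fin (m + 1)}
    (hk : k = p ∨ k = q) {h : Config (m + 1) → ℂ} (hh : Continuous h) (hflat : ∀ X z, h (Function.update X k z) = h X)
    (h1 : ∫ X in cellN (m + 1) L, ‖h X‖ ^ 2 ≤ 1) :
    ∫ X in cellN (m + 1) L, (periodizedPotential v L (X p - X q)).toReal * ‖h X‖ ^ 2 ≤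
      ((ENNReal.ofReal (L ^ 3))⁻¹ * ∫⁻ x : Space, v ‖x‖).toReal := by
  rw [integral_pairWeight_norm_sq_flat_int hL hv hfin hint hpq hk hh hflat]
  exact (mul_le_mul_of_nonneg_left h1 ENNReal.toReal_nonneg).trans_eq (mul_one _)

/-- `∫ v^per_{pq}|b_kψ|² ≤ L⁻³‖v‖₁` for `k ∈ {p,q}` (`|b_kψ| = |P_kψ|` is flat in slot `k`). [folklore] -/
theorem pair_sq_up_le_int (hL : 0 < L) (hv : IsRepulsiveFiniteRange v) (hfin : ∀ x, periodizedPotential v L x ≠ ⊤)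
    (hint : (∫⁻ x : Space, v ‖x‖) ≠ ⊤) (hpq : p ≠ q) (hψ : Continuous ψ)
    (hψ1 : ∫ X in cellN (m + 1) L, ‖ψ X‖ ^ 2 ≤ 1) (n : Fin 3 → ℤ) {k : Fin (m + 1)} (hk : k = p ∨ k = q) :
    ∫ X in cellN (m + 1) L, (periodizedPotential v L (X p - X q)).toReal *
        ‖cellWave L n (X k) * cellAvg (m + 1) L k ψ X‖ ^ 2 ≤
      ((ENNReal.ofReal (L ^ 3))⁻¹ * ∫⁻ x : Space, v ‖x‖).toReal := by
  simp only [norm_up]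
  exact integral_pairWeight_norm_sq_le_int hL hv hfin hint hpq hk (continuous_cellAvg k hψ) (cellAvg_update k ψ)
    ((integral_norm_sq_cellAvg_le hL k hψ).trans hψ1)

/-- `∫ v^per_{pq}|P_k^{(n)}ψ|² ≤ L⁻³‖v‖₁` for `k ∈ {p,q}`. [folklore] -/
theorem pair_sq_down_le_int (hL : 0 < L) (hv : IsRepulsiveFiniteRange v) (hfin : ∀ x, periodizedPotential v L x ≠ ⊤)
    (hint : (∫⁻ x : Space, v ‖x‖) ≠ ⊤) (hpq : p ≠ q) (hψ : Continuous ψ)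
    (hψ1 : ∫ X in cellN (m + 1) L, ‖ψ X‖ ^ 2 ≤ 1) (n : Fin 3 → ℤ) {k : Fin (m + 1)} (hk : k = p ∨ k = q) :
    ∫ X in cellN (m + 1) L, (periodizedPotential v L (X p - X q)).toReal * ‖fourierAvg m L n k ψ X‖ ^ 2 ≤
      ((ENNReal.ofReal (L ^ 3))⁻¹ * ∫⁻ x : Space, v ‖x‖).toReal :=
  integral_pairWeight_norm_sq_le_int hL hv hfin hint hpq hk (continuous_fourierAvg n k hψ) (fourierAvg_update n k ψ)
    ((integral_norm_sq_fourierAvg_le hL n k hψ).trans hψ1)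

/-- `∫ v^per_{pq}|b_k P_j^{(n)}ψ|² ≤ L⁻³‖v‖₁` for `k ∈ {p,q}`. [folklore] -/
theorem pair_sq_up_down_le_int (hL : 0 < L) (hv : IsRepulsiveFiniteRange v)
    (hfin : ∀ x, periodizedPotential v L x ≠ ⊤) (hint : (∫⁻ x : Space, v ‖x‖) ≠ ⊤) (hpq : p ≠ q)
    (hψ : Continuous ψ) (hψ1 : ∫ X in cellN (m + 1) L, ‖ψ X‖ ^ 2 ≤ 1) (n : Fin 3 → ℤ) {k : Fin (m + 1)}
    (hk : k = p ∨ k = q) (j : Fin (m + 1)) :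
    ∫ X in cellN (m + 1) L, (periodizedPotential v L (X p - X q)).toReal *
        ‖cellWave L n (X k) * cellAvg (m + 1) L k (fourierAvg m L n j ψ) X‖ ^ 2 ≤
      ((ENNReal.ofReal (L ^ 3))⁻¹ * ∫⁻ x : Space, v ‖x‖).toReal := by
  have hF : Continuous (fourierAvg m L n j ψ) := continuous_fourierAvg n j hψ
  simp only [norm_up]
  exact integral_pairWeight_norm_sq_le_int hL hv hfin hint hpq hk (continuous_cellAvg k hF) (cellAvg_update k _)
    (((integral_norm_sq_cellAvg_le hL k hF).trans (integral_norm_sq_fourierAvg_le hL n j hψ)).trans hψ1)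

/-- `∫ v^per_{pq}|P_k^{(n)} b_jψ|² ≤ L⁻³‖v‖₁` for `k ∈ {p,q}`. [folklore] -/
theorem pair_sq_down_up_le_int (hL : 0 < L) (hv : IsRepulsiveFiniteRange v)
    (hfin : ∀ x, periodizedPotential v L x ≠ ⊤) (hint : (∫⁻ x : Space, v ‖x‖) ≠ ⊤) (hpq : p ≠ q)
    (hψ : Continuous ψ) (hψ1 : ∫ X in cellN (m + 1) L, ‖ψ X‖ ^ 2 ≤ 1) (n : Fin 3 → ℤ) {k : Fin (m + 1)}
    (hk : k = p ∨ k = q) (j : Fin (m + 1)) :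
    ∫ X in cellN (m + 1) L, (periodizedPotential v L (X p - X q)).toReal *
        ‖fourierAvg m L n k (fun Y => cellWave L n (Y j) * cellAvg (m + 1) L j ψ Y) X‖ ^ 2 ≤
      ((ENNReal.ofReal (L ^ 3))⁻¹ * ∫⁻ x : Space, v ‖x‖).toReal := by
  have hb : Continuous fun Y => cellWave L n (Y j) * cellAvg (m + 1) L j ψ Y := continuous_up n j hψ
  refine integral_pairWeight_norm_sq_le_int hL hv hfin hint hpq hk (continuous_fourierAvg n k hb)
    (fourierAvg_update n k _) (((integral_norm_sq_fourierAvg_le hL n k hb).trans ?_).trans hψ1)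
  simp only [norm_up]
  exact integral_norm_sq_cellAvg_le hL j hψ

/-- **The four local bounds** for `i, j ∈ {p,q}` (finite periodisation, integrable lift): `|𝓥_pq(b_iψ,b_jψ)|,
|𝓥_pq(P_i^{(n)}ψ,P_j^{(n)}ψ)| ≤ L⁻³‖v‖₁` and `|𝓥_pq(b_iP_j^{(n)}ψ, ψ)|, |𝓥_pq(P_i^{(n)}b_jψ, ψ)| ≤
√(L⁻³‖v‖₁) √(∫v^per_{pq}|ψ|²)` (weighted Cauchy–Schwarz and Jensen in a slot of the pair). [folklore] -/
theorem pair_local_bounds_int (hL : 0 < L) (hv : IsRepulsiveFiniteRange v)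
    (hfin : ∀ x, periodizedPotential v L x ≠ ⊤) (hint : (∫⁻ x : Space, v ‖x‖) ≠ ⊤) (hpq : p ≠ q)
    (hψ : Continuous ψ) (hψ1 : ∫ X in cellN (m + 1) L, ‖ψ X‖ ^ 2 ≤ 1) (n : Fin 3 → ℤ) {i j : Fin (m + 1)}
    (hi : i = p ∨ i = q) (hj : j = p ∨ j = q) :
    ‖∫ X in cellN (m + 1) L, (((periodizedPotential v L (X p - X q)).toReal : ℝ) : ℂ) *
        (conj (cellWave L n (X i) * cellAvg (m + 1) L i ψ X) * (cellWave L n (X j) * cellAvg (m + 1) L j ψ X))‖ ≤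
        ((ENNReal.ofReal (L ^ 3))⁻¹ * ∫⁻ x : Space, v ‖x‖).toReal ∧
    ‖∫ X in cellN (m + 1) L, (((periodizedPotential v L (X p - X q)).toReal : ℝ) : ℂ) *
        (conj (fourierAvg m L n i ψ X) * fourierAvg m L n j ψ X)‖ ≤
        ((ENNReal.ofReal (L ^ 3))⁻¹ * ∫⁻ x : Space, v ‖x‖).toReal ∧
    ‖∫ X in cellN (m + 1) L, (((periodizedPotential v L (X p - X q)).toReal : ℝ) : ℂ) *
        (conj (cellWave L n (X i) * cellAvg (m + 1) L i (fourierAvg m L n j ψ) X) * ψ X)‖ ≤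
        Real.sqrt ((ENNReal.ofReal (L ^ 3))⁻¹ * ∫⁻ x : Space, v ‖x‖).toReal *
          Real.sqrt (∫ X in cellN (m + 1) L, (periodizedPotential v L (X p - X q)).toReal * ‖ψ X‖ ^ 2) ∧
    ‖∫ X in cellN (m + 1) L, (((periodizedPotential v L (X p - X q)).toReal : ℝ) : ℂ) *
        (conj (fourierAvg m L n i (fun Y => cellWave L n (Y j) * cellAvg (m + 1) L j ψ Y) X) * ψ X)‖ ≤
        Real.sqrt ((ENNReal.ofReal (L ^ 3))⁻¹ * ∫⁻ x : Space, v ‖x‖).toReal *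
          Real.sqrt (∫ X in cellN (m + 1) L, (periodizedPotential v L (X p - X q)).toReal * ‖ψ X‖ ^ 2) := by
  -- adapted from `pair_local_bounds_bdd` (bounded periodisation)
  have hW := integrableOn_pairWeight hL hv hint p q (n' := m)
  have hW0 : ∀ X : Config (m + 1), 0 ≤ (periodizedPotential v L (X p - X q)).toReal := fun X =>
    ENNReal.toReal_nonneg
  have hσ : Real.sqrt ((ENNReal.ofReal (L ^ 3))⁻¹ * ∫⁻ x : Space, v ‖x‖).toReal *
      Real.sqrt ((ENNReal.ofReal (L ^ 3))⁻¹ * ∫⁻ x : Space, v ‖x‖).toReal =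
        ((ENNReal.ofReal (L ^ 3))⁻¹ * ∫⁻ x : Space, v ‖x‖).toReal := Real.mul_self_sqrt ENNReal.toReal_nonneg
  have hFc : ∀ k, Continuous (fourierAvg m L n k ψ) := fun k => continuous_fourierAvg n k hψ
  refine ⟨?_, ?_, ?_, ?_⟩
  · refine (norm_form_le_sqrt_mul_sqrt_int hW hW0 (continuous_up n i hψ) (continuous_up n j hψ)).trans ?_
    rw [← hσ]
    exact mul_le_mul (Real.sqrt_le_sqrt (pair_sq_up_le_int hL hv hfin hint hpq hψ hψ1 n hi))
      (Real.sqrt_le_sqrt (pair_sq_up_le_int hL hv hfin hint hpq hψ hψ1 n hj)) (Real.sqrt_nonneg _)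
      (Real.sqrt_nonneg _)
  · refine (norm_form_le_sqrt_mul_sqrt_int hW hW0 (hFc i) (hFc j)).trans ?_
    rw [← hσ]
    exact mul_le_mul (Real.sqrt_le_sqrt (pair_sq_down_le_int hL hv hfin hint hpq hψ hψ1 n hi))
      (Real.sqrt_le_sqrt (pair_sq_down_le_int hL hv hfin hint hpq hψ hψ1 n hj)) (Real.sqrt_nonneg _)
      (Real.sqrt_nonneg _)
  · refine (norm_form_le_sqrt_mul_sqrt_int hW hW0 (continuous_up n i (hFc j)) hψ).trans ?_
    exact mul_le_mul_of_nonneg_right (Real.sqrt_le_sqrt (pair_sq_up_down_le_int hL hv hfin hint hpq hψ hψ1 n hi j))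
      (Real.sqrt_nonneg _)
  · refine (norm_form_le_sqrt_mul_sqrt_int hW hW0 (continuous_fourierAvg n i (continuous_up n j hψ)) hψ).trans ?_
    exact mul_le_mul_of_nonneg_right (Real.sqrt_le_sqrt (pair_sq_down_up_le_int hL hv hfin hint hpq hψ hψ1 n hi j))
      (Real.sqrt_nonneg _)

end OnePairInt

end PlainInteraction

/-- **Part 2 of `stub_bandEmptinessInt` (registered helper statement)**: the third local bound of one pair for a
profile with FINITE periodisation and INTEGRABLE lift at a side `L > 0` — for `p ≠ q`, `i, j ∈ {p,q}`, continuous `ψ`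
with `∫|ψ|² ≤ 1`, `|𝓥_pq(b_i P_j^{(n)} ψ, ψ)| ≤ √(L⁻³‖v‖₁) √(∫ v^per_pq |ψ|²)` (weighted Cauchy–Schwarz against the
integrable pair weight and Jensen in a slot of the pair). [folklore] (KennedyLiebShastry1988 §2; arXiv:1211.2778 §2;
LSSY2005 App. A) -/
theorem plainPairsInt_pair_local_bound : ∀ (v : ℝ → ENNReal) (m : ℕ) (L : ℝ), 0 < L → Literature.MathematicalPhysics.QuantumManyBody.BoseGas.IsRepulsiveFiniteRange v → (∀ x : Literature.MathematicalPhysics.QuantumManyBody.BoseGas.Space, Literature.MathematicalPhysics.QuantumManyBody.BoseGas.periodizedPotential v L x ≠ ⊤) → (∫⁻ x : Literature.MathematicalPhysics.QuantumManyBody.BoseGas.Space, v ‖x‖) ≠ ⊤ → ∀ (n : Fin 3 → ℤ) (p q : Fin (m + 1)), p ≠ q → ∀ (ψ : Literature.MathematicalPhysics.QuantumManyBody.BoseGas.Config (m + 1) → ℂ), Continuous ψ → ∫ X in Literature.MathematicalPhysics.QuantumManyBody.BoseGas.cellN (m + 1) L, ‖ψ X‖ ^ 2 ≤ 1 → ∀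 (i j : Fin (m + 1)), (i = p ∨ i = q) → (j = p ∨ j = q) → ‖∫ X in Literature.MathematicalPhysics.QuantumManyBody.BoseGas.cellN (m + 1) L, (((Literature.MathematicalPhysics.QuantumManyBody.BoseGas.periodizedPotential v L (X p - X q)).toReal : ℝ) : ℂ) * ((starRingEnd ℂ) (Literature.MathematicalPhysics.QuantumManyBody.BoseGas.cellWave L n (X i) * Summit.AtomisticToContinuum.BoseEinsteinCondensation.Theorems.GaussianDominationCan.Negative.cellAvg (m + 1) L i (Summit.AtomisticToContinuum.BoseEinsteinCondensation.Cruxes.GDTransfer.DysonDressedWitness.fourierAvg m L n j ψ) X) * ψ X)‖ ≤ Real.sqrt ((ENNReal.ofReal (L ^ 3))⁻¹ * ∫⁻ x : Literature.MathematicalPhysics.QuantumManyBody.BoseGas.Space, v ‖x‖).toReal * Real.sqrt (∫ X in Literature.MathematicalPhysics.QuantumManyBody.BoseGas.cellN (m + 1) L, (Literature.MathematicalPhysics.QuantumManyBody.BoseGas.periodizedPotential v L (X p - X q)).toReal * ‖ψ X‖ ^ 2) :=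
  fun _ _ _ hL hv hfin hint n _ _ hpq _ hψ hψ1 _ _ hi hj =>
    (PlainInteraction.pair_local_bounds_int hL hv hfin hint hpq hψ hψ1 n hi hj).2.2.1

end Summit.AtomisticToContinuum.BoseEinsteinCondensation.Cruxes.GDTransfer.Seeded

end
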